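import Summits.CriticalPhenomena.CardyFormulaZ2.Theses.CardyPolygonWords
import Literature.Probability.LatticeModels.PercolationPolygonWordProofs
import HarnessLib

/-!
# Route CardyPolygonWords — support item `RowTransferExactness` (stmt-CriticalPhenomena-5305)

The support item `RowTransferExactness` of route `CriticalPhenomena/CardyPolygonWords` (the
lattice dictionary: at an aligned mesh `δ = δ₀ / N` the G02 crossing probability of a marked
lattice polygon under bond percolation on `ℤ²` at `p = 1/2` is EXACTLY the amplitude
`⟨β| W |α⟩` of its transfer-matrix word) was filed informally; its typed form is the Literature
named fact `Literature.Probability.LatticeModels.RowTransferExactness`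
(`Literature/Probability/LatticeModels/PercolationPolygonWord.lean`), which is DISCHARGED in the
tree (`Literature.Probability.LatticeModels.RowTransferExactness_holds`,
`PercolationPolygonWordProofs.lean`; a second, label-based proof of the lattice-level identity is
the series `PolygonWordLevelGraph` / `PolygonWordRowSteps` / `PolygonWordCounting` /
`PolygonWordExactness`). This file records the route-side link: once the item is typed as that
`Prop` (route decl `…Theses.CardyPolygonWords.RowTransferExactness := Literature.…
.RowTransferExactness`), `rowTransferExactness_proof` closes it (`exact` unfolds the route def).
-/

namespace Summit.CriticalPhenomena.CardyFormulaZ2.Theorems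

/-- **Row-transfer exactness** (support item `RowTransferExactness` of route `CardyPolygonWords`,
stmt-CriticalPhenomena-5305, in its typed Literature form): for every conformal rectangle `R`
whose carrier is the open polyomino `polyominoCarrier δ₀ s` and every `N ≥ 1`,
`bondDomainCrossingProb R (δ₀ / N) = polygonWordAmplitude R (δ₀ / N)`. Unconditional: the named
fact is discharged in `Literature.Probability.LatticeModels.PercolationPolygonWordProofs`. -/
theorem rowTransferExactness_proof : Literature.Probability.LatticeModels.RowTransferExactness :=
  Literature.Probability.LatticeModels.RowTransferExactness_holds

end Summit.CriticalPhenomena.CardyFormulaZ2.Theorems
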